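import Summits.CriticalPhenomena.Ising3DConformalLimit.Theorems.MirrorHoelderCompactnessSeparableHoelderLattice
import Summits.CriticalPhenomena.Ising3DConformalLimit.Theorems.MirrorHoelderCompactnessSeparableHoelderFloors
import Summits.CriticalPhenomena.Ising3DConformalLimit.Theses.MirrorHoelderCompactness
import HarnessLib

/-!
# `SeparableHoelder` (item stmt-CriticalPhenomena-6151 of route MirrorHoelderCompactness): the
Hölder-1/2 modulus of the rescaled critical `ℤ³` Ising correlators in a nine-mirror-separable
variable, from two-point doubling

We prove the route decl `Summit.CriticalPhenomena.Ising3DConformalLimit.Theses.MirrorHoelderCompactness.SeparableHoelder`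
(`separableHoelder_proof`): assuming all-scale doubling `κ g(n) ≤ g(2n)` of the axial critical
two-point function `g(n) = ⟨σ₀σ_{ne₀}⟩_{β_c}` (the route's crux `TwoPointDoubling`), for every
`n`, every compact `K` of non-coincident configurations and every margin `m > 0` there are
`C, δ₀, h₀` such that for `δ < δ₀`, `x ∈ K` and a move of one point `x_i ↦ y`, `‖y - x_i‖ ≤ h₀`,
separated with margin `m` from the other points by one of the nine lattice-mirror normals
`e_i, e_i ± e_j`, the rescaled correlator `F = ρ★(δ)ⁿ ⟨∏ σ_{[x_k/δ]}⟩_{β_c}`,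
`ρ★(δ) = g(⌊1/δ⌋)^{-1/2}`, satisfies `|F(x with x_i ↦ y) - F(x)| ≤ C (‖y - x_i‖ + δ)^{1/2}`.

Proof (the card's mechanism, made quantitative). On the lattice (`…SeparableHoelderLattice`,
`sq_criticalCorr_sub_le`): reflection positivity in the lattice mirror of the separating family
placed at level distance `M ≈ m/(2δ)` from `[x_i/δ]` and the Cauchy–Schwarz inequality for its Gram
form bound `(⟨∏σ_X⟩ - ⟨∏σ_{X'}⟩)²` by a three-term second difference of the two-point function at
sup-norm `≈ m/δ`, controlled by the all-direction gradient estimate (reflection positivity through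
sites and bonds + Messager–Miracle-Solé, ADC 2021 Prop. 5.9 / DCP 2025 (1.11)) as
`≲ g(4q)/q · ‖X_i - X'_i‖₁` with `q ≈ m/(64δ)`, times the doubled-block correlator, bounded by
Newman's Gaussian inequality and Messager–Miracle-Solé by `(2n')! g(R)^{n'}` with `R ≈ r₀/δ`
(`r₀` = half the minimal pair distance on `K`, capped by `m/2`). Multiplying by
`ρ★(δ)^{2n} = g(⌊1/δ⌋)^{-n}`, doubling (iterated, with the axis monotonicity) bounds the ratios
`g(4q)/g(⌊1/δ⌋)` and `g(R)/g(⌊1/δ⌋)` by powers of `κ⁻¹` independent of `δ`, and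
`‖X_i - X'_i‖₁/q ≲ (‖y - x_i‖ + δ)/m`; taking square roots gives the exponent `1/2`.

References: Fröhlich–Israel–Lieb–Simon 1978 §2; Aizenman–Duminil-Copin 2021 (arXiv:1912.07973)
§5–6; Duminil-Copin–Panis 2025 (arXiv:2404.05700) (1.11); Messager–Miracle-Solé 1977; Newman
1975. No definitions are introduced.
-/

noncomputable section

open Finset Filter Set
open scoped BigOperators

namespace Summit.CriticalPhenomena.Ising3DConformalLimit.MirrorHoelderCompactnessSeparableHoelder

open Literature.Probability.LatticeModels
open Summit.CriticalPhenomena.Ising3DConformalLimit.Theses.MirrorHoelderCompactness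
  (TwoPointDoubling SeparableHoelder)

/-! ### Placing the mirror: offsets and orientations -/

/-- **The lattice step for a level family.** Let `Ψ` be one of the nine level functions, so that
for every integer offset `c` the mirror data of `{Ψ = c}` exist (`coordMirror` / `diagMirror` /
`antiMirror`). If `X, X'` differ only at `i`, the other sites are pairwise `R`-separated in sup-norm
and `Ψ`-separated from `X i` by at least `M + R` (on either side), and `16q + 2‖X i - X' i‖₁ ≤ M`
(`q ≥ 1`), then `(⟨∏σ_X⟩ - ⟨∏σ_{X'}⟩)² ≤ (2·g(4q)/(4q+1)·‖X i - X' i‖₁)·((2n')!·g(R)^{n'})`: put the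
mirror at offset `c = Ψ(X i) ± M` and apply `sq_criticalCorr_sub_le` / `sq_criticalCorr_sub_le'`.
[cite: FrohlichEtAl1978, §2] -/
theorem lattice_step (Ψ : Site 3 → ℤ)
    (hmir : ∀ c : ℤ, ∃ (Θ : Site 3 → Site 3) (φ : Site 3 → ℤ), (∀ v, φ v = Ψ v - c) ∧
      (∀ v, Θ (Θ v) = v) ∧ (∀ v, φ (Θ v) = -φ v) ∧
      (∀ (n : ℕ) (y : Fin n → Site 3), criticalCorr 3 n (Θ ∘ y) = criticalCorr 3 n y) ∧
      (∀ (m : ℕ) (k : Fin m → ℕ) (z : (a : Fin m) → Fin (k a) → Site 3) (cf : Fin m → ℝ),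
        (∀ a j, 0 ≤ φ (z a j)) →
        0 ≤ ∑ a, ∑ b, cf a * cf b * criticalCorr 3 (k a + k b) (Fin.append (Θ ∘ z a) (z b))) ∧
      (∀ v v', Site.supNorm (Θ v - Θ v') = Site.supNorm (v - v')) ∧
      (∀ v v', Site.l1Dist (Θ v) (Θ v') = Site.l1Dist v v') ∧
      (∀ v v', |φ v + φ v'| ≤ 2 * (Site.supNorm (Θ v - v') : ℤ)) ∧
      (∀ v v', |φ v - φ v'| ≤ (Site.l1Dist v v' : ℤ)))
    {n' : ℕ} (i : Fin (n' + 1)) (X X' : Fin (n' + 1) → Site 3) (hdiff : ∀ j, j ≠ i → X' j = X j)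
    (M R q : ℕ) (hq : 1 ≤ q) (hM : 16 * q + 2 * Site.l1Dist (X i) (X' i) ≤ M)
    (hsepB : ∀ j j', j ≠ i → j' ≠ i → j ≠ j' → R ≤ Site.supNorm (X j - X j'))
    (hside : (∀ j, j ≠ i → Ψ (X j) + M + R ≤ Ψ (X i)) ∨ (∀ j, j ≠ i → Ψ (X i) + M + R ≤ Ψ (X j))) :
    (criticalCorr 3 (n' + 1) X - criticalCorr 3 (n' + 1) X') ^ 2 ≤
      (2 * (criticalTwoPoint 3 (Pi.single 0 ((4 * q : ℕ) : ℤ)) / (4 * (q : ℝ) + 1)) *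
          Site.l1Dist (X i) (X' i)) *
        ((2 * n').factorial * criticalTwoPoint 3 (Pi.single 0 (R : ℤ)) ^ n') := by
  rcases hside with hs | hs
  · -- the moving site above the block: mirror at `Ψ (X i) - M`, orientation of `sq_criticalCorr_sub_le'`
    obtain ⟨Θ, φ, hφΨ, hinv, hφ, hsym, hRP, hsup, hl1, hlev, hlip⟩ := hmir (Ψ (X i) - M)
    have hφi : φ (X i) = M := by rw [hφΨ]; ring
    have hφi' : 0 ≤ φ (X' i) := by
      have h := hlip (X' i) (X i)
      rw [l1Dist_comm] at h
      have h2 : -(Site.l1Dist (X i) (X' i) : ℤ) ≤ φ (X' i) - φ (X i) := (abs_le.1 h).1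
      omega
    refine sq_criticalCorr_sub_le' hinv hφ hsym hRP hsup hl1 hlev i X X' hdiff (by omega) hφi' R
      (fun j hj => ?_) hsepB hq (by rw [hφi]; simpa using hM)
    rw [hφΨ]
    have := hs j hj
    omega
  · -- the moving site below the block: mirror at `Ψ (X i) + M`, orientation of `sq_criticalCorr_sub_le`
    obtain ⟨Θ, φ, hφΨ, hinv, hφ, hsym, hRP, hsup, hl1, hlev, hlip⟩ := hmir (Ψ (X i) + M)
    have hφi : φ (X i) = -M := by rw [hφΨ]; ring
    have hφi' : φ (X' i) ≤ 0 := by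
      have h := hlip (X' i) (X i)
      rw [l1Dist_comm] at h
      have h2 : φ (X' i) - φ (X i) ≤ Site.l1Dist (X i) (X' i) := (abs_le.1 h).2
      omega
    refine sq_criticalCorr_sub_le hinv hφ hsym hRP hsup hl1 hlev i X X' hdiff (by omega) hφi' R
      (fun j hj => ?_) hsepB hq (by rw [hφi]; simpa using hM)
    rw [hφΨ]
    have := hs j hj
    omega

/-- The nine level functions come with mirror data at every offset (`coordMirror`, `diagMirror`,
`antiMirror`). [cite: FrohlichEtAl1978, §3 Thm 3.1] -/
theorem mirror_data_of_level {u : EuclideanSpace ℝ (Fin 3)} {k l : Fin 3} (hkl : k ≠ l)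
    {Ψ : Site 3 → ℤ}
    (hΨ : (u = EuclideanSpace.single k 1 ∧ Ψ = fun V => V k) ∨
        (u = EuclideanSpace.single k 1 + EuclideanSpace.single l 1 ∧ Ψ = fun V => V k + V l) ∨
        (u = EuclideanSpace.single k 1 - EuclideanSpace.single l 1 ∧ Ψ = fun V => V k - V l))
    (c : ℤ) :
    ∃ (Θ : Site 3 → Site 3) (φ : Site 3 → ℤ), (∀ v, φ v = Ψ v - c) ∧
      (∀ v, Θ (Θ v) = v) ∧ (∀ v, φ (Θ v) = -φ v) ∧
      (∀ (n : ℕ) (y : Fin n → Site 3), criticalCorr 3 n (Θ ∘ y) = criticalCorr 3 n y) ∧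
      (∀ (m : ℕ) (k : Fin m → ℕ) (z : (a : Fin m) → Fin (k a) → Site 3) (cf : Fin m → ℝ),
        (∀ a j, 0 ≤ φ (z a j)) →
        0 ≤ ∑ a, ∑ b, cf a * cf b * criticalCorr 3 (k a + k b) (Fin.append (Θ ∘ z a) (z b))) ∧
      (∀ v v', Site.supNorm (Θ v - Θ v') = Site.supNorm (v - v')) ∧
      (∀ v v', Site.l1Dist (Θ v) (Θ v') = Site.l1Dist v v') ∧
      (∀ v v', |φ v + φ v'| ≤ 2 * (Site.supNorm (Θ v - v') : ℤ)) ∧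
      (∀ v v', |φ v - φ v'| ≤ (Site.l1Dist v v' : ℤ)) := by
  rcases hΨ with ⟨-, rfl⟩ | ⟨-, rfl⟩ | ⟨-, rfl⟩
  · exact coordMirror k c
  · obtain ⟨Θ, φ, h0, h⟩ := antiMirror hkl c
    exact ⟨Θ, φ, fun v => by rw [h0], h⟩
  · obtain ⟨Θ, φ, h0, h⟩ := diagMirror hkl c
    exact ⟨Θ, φ, fun v => by rw [h0], h⟩

/-! ### From the continuum configuration to the lattice estimate -/

/-- **The lattice estimate for a separated continuum configuration.** Fix `δ > 0`, integers
`q ≥ 1`, `M`, `R` with `16q + 6h₀/δ + 6 < M`, `R + 1 ≤ r₀/δ`, `M + R + 4 < m/δ`, a configuration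
`x` of `n' + 1` points pairwise `≥ 2r₀` apart, `‖y - x i‖ ≤ h₀`, and a nine-normal `u` separating
`x i` from the other points with margin `m`. Then the lattice approximations
`X = [x/δ]`, `X' = [x with x_i ↦ y / δ]` satisfy
`(⟨∏σ_X⟩ - ⟨∏σ_{X'}⟩)² ≤ (2·g(4q)/(4q+1)·‖[x_i/δ] - [y/δ]‖₁)·((2n')!·g(R)^{n'})` (`lattice_step`
for the level of `u`, after the floor bookkeeping). [cite: FrohlichEtAl1978, §2] -/
theorem lattice_ineq_of_separated {δ m r₀ h₀ : ℝ} (hδ0 : 0 < δ) {n' : ℕ}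
    (x : Fin (n' + 1) → EuclideanSpace ℝ (Fin 3)) (hsep : ∀ j j', j ≠ j' → 2 * r₀ ≤ ‖x j - x j'‖)
    (i : Fin (n' + 1)) (y : EuclideanSpace ℝ (Fin 3)) (hy : ‖y - x i‖ ≤ h₀)
    (hu : ∃ u : EuclideanSpace ℝ (Fin 3), (∃ i j : Fin 3, i ≠ j ∧ (u = EuclideanSpace.single i 1 ∨
        u = EuclideanSpace.single i 1 + EuclideanSpace.single j 1 ∨
        u = EuclideanSpace.single i 1 - EuclideanSpace.single j 1)) ∧
        ((∀ j : Fin (n' + 1), j ≠ i → inner ℝ u (x j) + m ≤ inner ℝ u (x i)) ∨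
          (∀ j : Fin (n' + 1), j ≠ i → inner ℝ u (x i) + m ≤ inner ℝ u (x j))))
    (q M R : ℕ) (hq : 1 ≤ q) (hqM : 16 * (q : ℝ) + 6 * (h₀ / δ) + 6 < M) (hR : (R : ℝ) + 1 ≤ r₀ / δ)
    (hMR : (M : ℝ) + R + 4 < m / δ) :
    (criticalCorr 3 (n' + 1) (fun j => latticeApprox δ (x j)) -
        criticalCorr 3 (n' + 1) (fun j => latticeApprox δ (Function.update x i y j))) ^ 2 ≤
      (2 * (criticalTwoPoint 3 (Pi.single 0 ((4 * q : ℕ) : ℤ)) / (4 * (q : ℝ) + 1)) *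
          Site.l1Dist (latticeApprox δ (x i)) (latticeApprox δ y)) *
        ((2 * n').factorial * criticalTwoPoint 3 (Pi.single 0 (R : ℤ)) ^ n') := by
  set X : Fin (n' + 1) → Site 3 := fun j => latticeApprox δ (x j) with hX
  set X' : Fin (n' + 1) → Site 3 := fun j => latticeApprox δ (Function.update x i y j) with hX'
  have hdiff : ∀ j, j ≠ i → X' j = X j := fun j hj => by
    simp only [hX', hX, Function.update_of_ne hj]
  have hX'i : X' i = latticeApprox δ y := by simp only [hX', Function.update_self]
  -- `16q + 2L ≤ M`
  have hL : (Site.l1Dist (X i) (X' i) : ℝ) ≤ 3 * (h₀ / δ) + 3 := by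
    rw [hX'i]
    refine (l1Dist_latticeApprox_le hδ0 (x i) y).trans ?_
    have h : ‖x i - y‖ / δ ≤ h₀ / δ := by
      rw [norm_sub_rev]; exact div_le_div_of_nonneg_right hy hδ0.le
    linarith
  have hqLM : 16 * q + 2 * Site.l1Dist (X i) (X' i) ≤ M := by
    have h : ((16 * q + 2 * Site.l1Dist (X i) (X' i) : ℕ) : ℝ) < M := by push_cast; linarith
    exact (show 16 * q + 2 * Site.l1Dist (X i) (X' i) < M by exact_mod_cast h).le
  -- pairwise sup-separation of the lattice block
  have hsepB : ∀ j j', j ≠ i → j' ≠ i → j ≠ j' → R ≤ Site.supNorm (X j - X j') := by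
    intro j j' _ _ hjj'
    obtain ⟨k₀, hk₀⟩ := exists_norm_le_two_mul_abs (x j - x j')
    have h1 : 2 * r₀ ≤ ‖x j - x j'‖ := hsep j j' hjj'
    have h2 : r₀ ≤ |x j k₀ - x j' k₀| := by rw [← PiLp.sub_apply]; linarith
    have h3 := abs_sub_div_le_natAbs_add_one hδ0 (x j) (x j') k₀
    have h4 : r₀ / δ ≤ |x j k₀ - x j' k₀| / δ := div_le_div_of_nonneg_right h2 hδ0.le
    have h5 : (R : ℝ) ≤ ((latticeApprox δ (x j) k₀ - latticeApprox δ (x j') k₀).natAbs : ℕ) := by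
      linarith
    have h6 : R ≤ (latticeApprox δ (x j) k₀ - latticeApprox δ (x j') k₀).natAbs := by exact_mod_cast h5
    have h7 := Site.natAbs_le_supNorm (X j - X j') k₀
    simp only [hX, Pi.sub_apply] at h7 ⊢
    omega
  -- the separating level
  obtain ⟨u, ⟨k, l, hkl, hu⟩, hside⟩ := hu
  obtain ⟨Ψ, hΨ, hΨapprox⟩ := level_latticeApprox δ hu
  have hsideZ : (∀ j, j ≠ i → Ψ (X j) + M + R ≤ Ψ (X i)) ∨ (∀ j, j ≠ i → Ψ (X i) + M + R ≤ Ψ (X j)) := by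
    rcases hside with hs | hs
    · refine Or.inl fun j hj => ?_
      have h1 : (inner ℝ u (x j) + m) / δ ≤ inner ℝ u (x i) / δ :=
        div_le_div_of_nonneg_right (hs j hj) hδ0.le
      rw [add_div] at h1
      have h2 := (abs_le.1 (hΨapprox (x j))).2
      have h3 := (abs_le.1 (hΨapprox (x i))).1
      have h5 : ((Ψ (X j) + M + R : ℤ) : ℝ) < Ψ (X i) := by
        push_cast
        linarith only [h1, h2, h3, hMR]
      exact (show Ψ (X j) + M + R < Ψ (X i) by exact_mod_cast h5).le
    · refine Or.inr fun j hj => ?_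
      have h1 : (inner ℝ u (x i) + m) / δ ≤ inner ℝ u (x j) / δ :=
        div_le_div_of_nonneg_right (hs j hj) hδ0.le
      rw [add_div] at h1
      have h2 := (abs_le.1 (hΨapprox (x j))).1
      have h3 := (abs_le.1 (hΨapprox (x i))).2
      have h5 : ((Ψ (X i) + M + R : ℤ) : ℝ) < Ψ (X j) := by
        push_cast
        linarith only [h1, h2, h3, hMR]
      exact (show Ψ (X i) + M + R < Ψ (X j) by exact_mod_cast h5).le
  have hlat := lattice_step Ψ (mirror_data_of_level hkl hΨ) i X X' hdiff M R q hq hqLM hsepB hsideZ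
  rw [hX'i] at hlat
  exact hlat

/-! ### The estimate for one configuration -/

/-- **The Hölder estimate for one configuration with separated points.** Given doubling with
constant `κ`, an order `n' + 1`, a margin `m > 0` and a pair-separation scale `r₀ ∈ (0, m/2]`, there
are `C, δ₀, h₀ > 0` such that for `δ < δ₀`, every configuration `x` of `n' + 1` points pairwise
`≥ 2r₀` apart, every `i`, `y` with `‖y - x i‖ ≤ h₀` and nine-normal separation of `x i` with margin
`m`: `|F(x with x_i ↦ y) - F(x)| ≤ C (‖y - x_i‖ + δ)^{1/2}`. Constants: `h₀ = m/32`,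
`δ₀ = min (min 1 (m/128)) (r₀/12)`, `C² = 192 (2n')! κ^{-J₁} κ^{-J₂ n'}/m` with `2^{J₁} m ≥ 32`,
`2^{J₂} r₀ ≥ 2`. [cite: AizenmanDuminilCopinAnnals2021, arXiv:1912.07973 Proposition 5.9 and §6.3] -/
theorem hoelder_core {κ : ℝ} (hκ : 0 < κ)
    (hdouble : ∀ t : ℕ, 1 ≤ t → κ * criticalTwoPoint 3 (Pi.single 0 (t : ℤ)) ≤
      criticalTwoPoint 3 (Pi.single 0 ((2 * t : ℕ) : ℤ)))
    (n' : ℕ) {m : ℝ} (hm : 0 < m) {r₀ : ℝ} (hr₀ : 0 < r₀) (hr₀m : r₀ ≤ m / 2) :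
    ∃ C δ₀ h₀ : ℝ, 0 < δ₀ ∧ 0 < h₀ ∧ ∀ δ ∈ Set.Ioo 0 δ₀, ∀ (x : Fin (n' + 1) → EuclideanSpace ℝ (Fin 3)),
      (∀ j j', j ≠ j' → 2 * r₀ ≤ ‖x j - x j'‖) →
      ∀ (i : Fin (n' + 1)) (y : EuclideanSpace ℝ (Fin 3)), ‖y - x i‖ ≤ h₀ →
      (∃ u : EuclideanSpace ℝ (Fin 3), (∃ i j : Fin 3, i ≠ j ∧ (u = EuclideanSpace.single i 1 ∨
        u = EuclideanSpace.single i 1 + EuclideanSpace.single j 1 ∨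
        u = EuclideanSpace.single i 1 - EuclideanSpace.single j 1)) ∧
        ((∀ j : Fin (n' + 1), j ≠ i → inner ℝ u (x j) + m ≤ inner ℝ u (x i)) ∨
          (∀ j : Fin (n' + 1), j ≠ i → inner ℝ u (x i) + m ≤ inner ℝ u (x j)))) →
      |rescaledCorrelator (criticalCorr 3)
            (fun δ : ℝ => (criticalTwoPoint 3 (Pi.single 0 ⌊δ⁻¹⌋)) ^ (-(1 / 2 : ℝ))) (n' + 1) δ
            (Function.update x i y) -
          rescaledCorrelator (criticalCorr 3)
            (fun δ : ℝ => (criticalTwoPoint 3 (Pi.single 0 ⌊δ⁻¹⌋)) ^ (-(1 / 2 : ℝ))) (n' + 1) δ x| ≤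
        C * (‖y - x i‖ + δ) ^ (1 / 2 : ℝ) := by
  -- the axis two-point function, its doubling and monotonicity
  set g : ℕ → ℝ := fun t => criticalTwoPoint 3 (Pi.single 0 (t : ℤ)) with hg
  have hgpos : ∀ t, 0 < g t := fun t => criticalTwoPoint_single_pos t
  have hdouble' : ∀ t : ℕ, 1 ≤ t → κ * g t ≤ g (2 * t) := fun t ht => hdouble t ht
  have hanti : ∀ a b : ℕ, 1 ≤ a → a ≤ b → g b ≤ g a := fun a b _ hab =>
    criticalTwoPoint_single_anti hab
  have hratio : ∀ (J : ℕ) {t N : ℕ}, 1 ≤ t → 1 ≤ N → N ≤ 2 ^ J * t → g t * (g N)⁻¹ ≤ κ⁻¹ ^ J :=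
    fun J t N ht hN hle => by
      rw [mul_inv_le_iff₀ (hgpos N)]
      exact le_inv_pow_mul_of_doubling_of_le hκ hdouble' hanti J ht hN hle
  -- the two dyadic depths
  obtain ⟨J₁, hJ₁⟩ : ∃ J₁ : ℕ, 32 / m < 2 ^ J₁ := pow_unbounded_of_one_lt _ one_lt_two
  obtain ⟨J₂, hJ₂⟩ : ∃ J₂ : ℕ, 2 / r₀ < 2 ^ J₂ := pow_unbounded_of_one_lt _ one_lt_two
  have hJ₁' : 1 ≤ 2 ^ J₁ * m / 32 := by
    have := (div_lt_iff₀ hm).1 hJ₁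
    rw [le_div_iff₀ (by norm_num)]; linarith
  have hJ₂' : 1 ≤ 2 ^ J₂ * r₀ / 2 := by
    have := (div_lt_iff₀ hr₀).1 hJ₂
    rw [le_div_iff₀ (by norm_num)]; linarith
  -- constants
  set A : ℝ := 192 * (2 * n').factorial * κ⁻¹ ^ J₁ * (κ⁻¹ ^ J₂) ^ n' / m with hA
  have hA0 : 0 ≤ A := by positivity
  refine ⟨Real.sqrt A, min (min 1 (m / 128)) (r₀ / 12), m / 32, by positivity, by positivity, ?_⟩
  intro δ hδ x hsep i y hy hu
  obtain ⟨hδ0, hδ1⟩ := hδ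
  have hδ_one : δ < 1 := lt_of_lt_of_le hδ1 ((min_le_left _ _).trans (min_le_left _ _))
  have hδm : δ ≤ m / 128 := hδ1.le.trans ((min_le_left _ _).trans (min_le_right _ _))
  have hδr : δ ≤ r₀ / 12 := hδ1.le.trans (min_le_right _ _)
  -- the integer scales and the lattice estimate
  obtain ⟨q, M, R, hq1, h4q, h16q, hMle, hMgt, hR1, hRle, hRgt, hMR⟩ :=
    exists_scales hm hr₀ hr₀m hδ0 hδm hδr
  have ht : 128 ≤ m / δ := by rw [le_div_iff₀ hδ0]; linarith
  have hh₀ : m / 32 / δ = m / δ / 32 := by ring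
  have hlat := lattice_ineq_of_separated (m := m) (r₀ := r₀) (h₀ := m / 32) hδ0 x hsep i y hy hu
    q M R hq1 (by rw [hh₀]; linarith) (by linarith) (by linarith)
  -- the mesh scale `N = ⌊1/δ⌋`
  set N : ℕ := ⌊δ⁻¹⌋.toNat with hN
  have hδinv : 1 < δ⁻¹ := (one_lt_inv₀ hδ0).2 hδ_one
  have hNZ : ((N : ℕ) : ℤ) = ⌊δ⁻¹⌋ := Int.toNat_of_nonneg (Int.floor_nonneg.2 (by linarith))
  have hN1 : 1 ≤ N := by
    have : (1 : ℤ) ≤ ⌊δ⁻¹⌋ := Int.le_floor.2 (by push_cast; linarith)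
    omega
  have hNle : (N : ℝ) ≤ δ⁻¹ := by
    have h := Int.floor_le δ⁻¹
    have h2 : ((N : ℤ) : ℝ) = (⌊δ⁻¹⌋ : ℝ) := by exact_mod_cast hNZ
    have h3 : ((N : ℤ) : ℝ) = (N : ℝ) := by norm_cast
    linarith
  have hinv_eq : δ⁻¹ = m / δ / 32 * (32 / m) := by field_simp
  have hinv_eq' : δ⁻¹ = r₀ / δ / 2 * (2 / r₀) := by field_simp
  -- the three ratio bounds
  have hb1 : g (4 * q) * (g N)⁻¹ ≤ κ⁻¹ ^ J₁ := by
    refine hratio J₁ (by omega) hN1 ?_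
    have h : (N : ℝ) ≤ 2 ^ J₁ * ((4 * q : ℕ) : ℝ) := by
      push_cast
      have h2 : δ⁻¹ ≤ 2 ^ J₁ * (m / δ / 32) := by
        rw [hinv_eq, mul_comm ((2 : ℝ) ^ J₁)]
        exact mul_le_mul_of_nonneg_left (by linarith) (by positivity)
      have h3 : (2 : ℝ) ^ J₁ * (m / δ / 32) ≤ 2 ^ J₁ * (4 * (q : ℝ)) :=
        mul_le_mul_of_nonneg_left h4q (by positivity)
      linarith
    exact_mod_cast h
  have hb2 : g R * (g N)⁻¹ ≤ κ⁻¹ ^ J₂ := by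
    refine hratio J₂ hR1 hN1 ?_
    have h : (N : ℝ) ≤ 2 ^ J₂ * (R : ℝ) := by
      have hR2 : r₀ / δ / 2 ≤ R := by
        have : 12 ≤ r₀ / δ := by rw [le_div_iff₀ hδ0]; linarith
        linarith
      have h2 : δ⁻¹ ≤ 2 ^ J₂ * (r₀ / δ / 2) := by
        rw [hinv_eq', mul_comm ((2 : ℝ) ^ J₂)]
        exact mul_le_mul_of_nonneg_left (by linarith) (by positivity)
      have h3 : (2 : ℝ) ^ J₂ * (r₀ / δ / 2) ≤ 2 ^ J₂ * (R : ℝ) :=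
        mul_le_mul_of_nonneg_left hR2 (by positivity)
      linarith
    exact_mod_cast h
  have hs0 : 0 ≤ ‖y - x i‖ + δ := by positivity
  have hb3 : (Site.l1Dist (latticeApprox δ (x i)) (latticeApprox δ y) : ℝ) / (4 * (q : ℝ) + 1) ≤
      96 * (‖y - x i‖ + δ) / m := by
    have hL := l1Dist_latticeApprox_le hδ0 (x i) y
    have h1 : (Site.l1Dist (latticeApprox δ (x i)) (latticeApprox δ y) : ℝ) ≤
        3 * ((‖y - x i‖ + δ) / δ) := by
      rw [add_div, div_self hδ0.ne', norm_sub_rev]; linarith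
    have h2 : 3 * ((‖y - x i‖ + δ) / δ) = 96 * (‖y - x i‖ + δ) / m * (m / δ / 32) := by
      field_simp; ring
    have h3 : 96 * (‖y - x i‖ + δ) / m * (m / δ / 32) ≤ 96 * (‖y - x i‖ + δ) / m * (4 * (q : ℝ) + 1) :=
      mul_le_mul_of_nonneg_left (by linarith) (by positivity)
    rw [div_le_iff₀ (by positivity)]
    linarith
  -- assembling the square bound
  have hρ2 : ((criticalTwoPoint 3 (Pi.single 0 ⌊δ⁻¹⌋)) ^ (-(1 / 2 : ℝ))) ^ 2 = (g N)⁻¹ := by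
    rw [rhoStar_sq]
    show _ = (criticalTwoPoint 3 (Pi.single 0 ((N : ℕ) : ℤ)))⁻¹
    rw [hNZ]
  have hsq : (rescaledCorrelator (criticalCorr 3)
        (fun δ : ℝ => (criticalTwoPoint 3 (Pi.single 0 ⌊δ⁻¹⌋)) ^ (-(1 / 2 : ℝ))) (n' + 1) δ
        (Function.update x i y) -
      rescaledCorrelator (criticalCorr 3)
        (fun δ : ℝ => (criticalTwoPoint 3 (Pi.single 0 ⌊δ⁻¹⌋)) ^ (-(1 / 2 : ℝ))) (n' + 1) δ x) ^ 2 ≤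
      A * (‖y - x i‖ + δ) := by
    rw [rescaledCorrelator_apply, rescaledCorrelator_apply, ← mul_sub, mul_pow, ← pow_mul,
      mul_comm (n' + 1) 2, pow_mul, hρ2,
      show (criticalCorr 3 (n' + 1) (fun j => latticeApprox δ (Function.update x i y j)) -
          criticalCorr 3 (n' + 1) (fun j => latticeApprox δ (x j))) ^ 2 =
        (criticalCorr 3 (n' + 1) (fun j => latticeApprox δ (x j)) -
          criticalCorr 3 (n' + 1) (fun j => latticeApprox δ (Function.update x i y j))) ^ 2 by ring]
    have h := sq_bound_assemble (hgpos N) (criticalTwoPoint_nonneg' _) (criticalTwoPoint_nonneg' _)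
      (Nat.cast_nonneg _) (by positivity : (0 : ℝ) < 4 * (q : ℝ) + 1) (Nat.cast_nonneg _) hlat
      hb1 hb2 hb3
    refine h.trans (le_of_eq ?_)
    rw [hA]
    field_simp
    ring
  -- square roots
  calc |rescaledCorrelator (criticalCorr 3)
          (fun δ : ℝ => (criticalTwoPoint 3 (Pi.single 0 ⌊δ⁻¹⌋)) ^ (-(1 / 2 : ℝ))) (n' + 1) δ
          (Function.update x i y) -
        rescaledCorrelator (criticalCorr 3)
          (fun δ : ℝ => (criticalTwoPoint 3 (Pi.single 0 ⌊δ⁻¹⌋)) ^ (-(1 / 2 : ℝ))) (n' + 1) δ x|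
      ≤ Real.sqrt (A * (‖y - x i‖ + δ)) := Real.abs_le_sqrt hsq
    _ = Real.sqrt A * (‖y - x i‖ + δ) ^ (1 / 2 : ℝ) := by
        rw [Real.sqrt_mul hA0, Real.sqrt_eq_rpow (‖y - x i‖ + δ)]

/-! ### The item -/

/-- **`SeparableHoelder`** (item stmt-CriticalPhenomena-6151 of route MirrorHoelderCompactness; the
card's theorem, mirror-hoelder-modulus L1 + L2 ⇒ Hölder-1/2 modulus, continuum form, conditional
on two-point doubling): with `ρ★(δ) := ⟨σ₀σ_{⌊1/δ⌋e₁}⟩^{-1/2}`, for every `n`, every compact `K` of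
non-coincident configurations and every margin `m > 0` there are `C, δ₀, h₀` such that for
`δ < δ₀`, `x ∈ K`, and a move of ONE point `x_i ↦ y` with `‖y - x_i‖ ≤ h₀`, if some nine-mirror
normal `u ∈ {e_i, e_i ± e_j}` separates `x_i` from the other points with margin `m`, then
`|F_n^δ(x with x_i ↦ y) - F_n^δ(x)| ≤ C (‖y - x_i‖ + δ)^{1/2}`,
`F_n^δ := rescaledCorrelator (criticalCorr 3) ρ★ n δ` (`hoelder_core` on each compact, with the
pair-separation constant of `exists_pairSep`). [cite: FrohlichEtAl1978, §2] -/
theorem separableHoelder_proof : SeparableHoelder := by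
  intro hD n K hKs hK m hm
  obtain ⟨κ, hκ, hdouble⟩ := hD
  cases n with
  | zero => exact ⟨0, 1, 1, one_pos, one_pos, fun δ _ x _ i => Fin.elim0 i⟩
  | succ n' =>
    obtain ⟨r, hr, hrK⟩ := exists_pairSep hKs hK
    have hdouble' : ∀ t : ℕ, 1 ≤ t → κ * criticalTwoPoint 3 (Pi.single 0 (t : ℤ)) ≤
        criticalTwoPoint 3 (Pi.single 0 ((2 * t : ℕ) : ℤ)) := fun t ht => by
      have h := hdouble t ht
      push_cast at h ⊢
      exact h
    obtain ⟨C, δ₀, h₀, hδ₀, hh₀, H⟩ := hoelder_core hκ hdouble' n' hm (r₀ := min (r / 2) (m / 2))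
      (by positivity) (min_le_right _ _)
    refine ⟨C, δ₀, h₀, hδ₀, hh₀, fun δ hδ x hx i y hy hsep => H δ hδ x (fun j j' hjj' => ?_) i y hy hsep⟩
    have h1 := hrK x hx j j' hjj'
    have h2 : min (r / 2) (m / 2) ≤ r / 2 := min_le_left _ _
    linarith

end Summit.CriticalPhenomena.Ising3DConformalLimit.MirrorHoelderCompactnessSeparableHoelder

end
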